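import Summits.Ventures.PercRepro.S1KillMixed

/-!
# PercRepro — THE KILL CONSUMER WITH A MIXED FAMILY AND PER-`t` CAPS (p2, gen 26; SUBCLAIM-S1 §6.10)

`rls_of_kill_case` with (i) the kill of `mk t` triangles AND `m₄ t` four-circuits at once (S1KillMixed), (ii) the
four-circuit cap supplied per triangle count, `S : ℕ → ℕ`, and (iii) the split by the four-circuit count `u = s₄`:
`u < m₄ t` by the plain line at the cap `m₄ t − 1` with the triangle kill, `u ≥ m₄ t` by the mixed kill at the cap
`S t`. The consumer of the `(9, 9)` cell, whose lines `t = 0, 1, 2` need `3 / 2 / 1` four-circuits in the kill.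

* `cellYsum_kill_le_mixed`, `weighted_of_ladderOK_kill_mixed` — the mixed kill in the cell form;
* **`rls_of_kill_case_mixed_capT`** — the coloop-free case of a cell on the mixed kill with per-`t` caps.
Axioms: standard.
-/

open scoped Matroid

namespace PercRepro

namespace S1

open Set

variable {α : Type}

/-- **The cell form's `Y`-bound with the mixed kill**: on the capped core, for `m₃` triangles and `m₄` four-circuits
pairwise covering `≥ 5` points, `cellYsum + 7560·(m₃·C(n − 3, p − 3) + m₄·C(n − 4, p − 4)) ≤ 7560·#Y(p, 4) + cellR34 +
7560·C(m₃ + m₄, 2)·C(n − 5, p − 5)`. -/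
theorem cellYsum_kill_le_mixed (M : Matroid α) [M.Finite] (p d P S S5 : ℕ) (hd4 : 4 ≤ d) (hR : M.eRank = (p : ℕ∞))
    (hn : M.E.ncard = p + d)
    (hfree : ∀ e ∈ M.E, ∃ A ⊆ M.E \ {e}, e ∉ M.closure A ∧ e ∉ M.closure ((M.E \ {e}) \ A))
    (hP : {C : Set α | M.IsCircuit C ∧ C.ncard = 3}.ncard ≤ P) (hS : {C : Set α | M.IsCircuit C ∧ C.ncard = 4}.ncard ≤ S)
    (hS5 : {C : Set α | M.IsCircuit C ∧ C.ncard = 5}.ncard ≤ S5)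
    (hp : 5 ≤ p) (𝒯₃ 𝒯₄ : Finset (Set α)) (h𝒯₃ : ∀ C ∈ 𝒯₃, M.IsCircuit C ∧ C.ncard = 3)
    (h𝒯₄ : ∀ C ∈ 𝒯₄, M.IsCircuit C ∧ C.ncard = 4)
    (hpair : ∀ C ∈ 𝒯₃ ∪ 𝒯₄, ∀ C' ∈ 𝒯₃ ∪ 𝒯₄, C ≠ C' → 5 ≤ (C ∪ C').ncard) :
    cellYsum p d + 7560 * (𝒯₃.card * (p + d - 3).choose (p - 3) + 𝒯₄.card * (p + d - 4).choose (p - 4)) ≤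
      7560 * Matroid.midCount M p 4 + cellR34 p d P S S5 +
        7560 * ((𝒯₃.card + 𝒯₄.card).choose 2 * (p + d - 5).choose (p - 5)) := by
  unfold cellR34 cellYsum
  simp only [CoreRegimes.chooseF_eq]
  classical
  have hL : ∀ e ∈ M.E, ¬ M.IsLoop e := ThmN.not_isLoop_of_free M hfree
  have hs : ∀ e ∈ M.E, ∀ f ∈ M.E, e ≠ f → M.eRk {e, f} = 2 := by
    intro e he f hf hef
    have h2 : (2 : ℕ∞) ≤ M.eRk {e, f} :=
      ThmN.two_le_eRk_of_two_le_ncard_of_free M hfree (pair_subset he hf) (by rw [ncard_pair hef])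
    have h3 : M.eRk {e, f} ≤ 2 := by
      have := M.eRk_le_encard {e, f}
      rwa [encard_pair hef] at this
    exact le_antisymm h3 h2
  have hcirc : ∀ C, M.IsCircuit C → 3 ≤ C.encard := ThmN.three_le_encard_of_circuit M hL hs
  have hline : ∀ L ⊆ M.E, M.eRk L ≤ 2 → L.ncard ≤ 3 := by
    intro L hL' hr
    have := ThmN.ncard_add_one_le_two_pow_of_eRk_le M hL hfree 2 L hL' hr
    omega
  have hplane : ∀ P ⊆ M.E, M.eRk P ≤ 3 → P.ncard ≤ 6 := fun P hP hr =>
    ThmN.ncard_le_six_of_eRk_le_three_of_free M hfree hP hr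
  have hten : ∀ X ⊆ M.E, M.eRk X ≤ 4 → X.ncard ≤ 10 := fun X hX hr =>
    ThmN.ncard_le_ten_of_eRk_le_four_of_free M hfree hX hr
  have hd : M.E.encard = M.eRank + d := by
    rw [hR, ← M.ground_finite.cast_ncard_eq, hn]
    push_cast
    ring
  set s3 := {C : Set α | M.IsCircuit C ∧ C.ncard = 3}.ncard with hs3
  set s4 := {C : Set α | M.IsCircuit C ∧ C.ncard = 4}.ncard with hs4
  set s5 := {C : Set α | M.IsCircuit C ∧ C.ncard = 5}.ncard with hs5
  have hb3 : s3 ≤ min (min (d * (d + 1) / 2) ((d * d + 6 - 3 * d) / 2)) P := by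
    have h := two_mul_ncard_triangles_le M (fun L hL hr => hline L hL hr.le) hd
    have h' : 2 * s3 ≤ d * (d + 1) := h
    have h2 := two_mul_ncard_triangles_add_three_mul_le_of_four_le M
      (fun L hL hr => hline L hL hr.le) hplane hd4 hd
    have h2' : 2 * s3 + 3 * d ≤ d * d + 6 := h2
    refine le_min (le_min ?_ ?_) hP
    · rw [Nat.le_div_iff_mul_le (by norm_num)]; omega
    · rw [Nat.le_div_iff_mul_le (by norm_num)]; omega
  have hb4 : s4 ≤ min (min (min ((d + 3).choose 4) (d * (d + 1) * (d + 2) / 3)) (fourCircuitBound d)) S := by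
    refine le_min (le_min (le_min (ncard_circuits_four_le M hd) ?_) (ncard_fourCircuits_le_fourCircuitBound M hfree hd)) hS
    have h := three_mul_ncard_four_circuits_le M hline hplane hd
    have h' : 3 * s4 ≤ d * (d + 1) * (d + 2) := h
    rw [Nat.le_div_iff_mul_le (by norm_num)]
    omega
  have hb5 : s5 ≤ min ((d + 4).choose 5) S5 := le_min (ncard_circuits_five_le M hd) hS5
  have hY := midCount_ge_K7_kill_mixed M hcirc hline hplane hten hd p hp 𝒯₃ 𝒯₄ h𝒯₃ h𝒯₄ hpair
  rw [hn] at hY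
  set m := min (5 * d) (p + d) with hm
  set s3B := min (min (d * (d + 1) / 2) ((d * d + 6 - 3 * d) / 2)) P with hs3B
  set s4B := min (min (min ((d + 3).choose 4) (d * (d + 1) * (d + 2) / 3)) (fourCircuitBound d)) S with hs4B
  set s5B := min ((d + 4).choose 5) S5 with hs5B
  set piAll := s3 * (p + d - 3).choose 2 + s4 * (p + d - 4) + s5 with hpiAll
  set piS0 := s3 * (m - 3).choose 2 + s4 * (m - 4) + s5 with hpiS0
  set piAllB := s3B * (p + d - 3).choose 2 + s4B * (p + d - 4) + s5B with hpiAllB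
  set piS0B := s3B * (m - 3).choose 2 + s4B * (m - 4) + s5B with hpiS0B
  have hpiAll_le : piAll ≤ piAllB := by
    rw [hpiAll, hpiAllB]; gcongr
  have hpiS0_le : piS0 ≤ piS0B := by
    rw [hpiS0, hpiS0B]; gcongr
  have hR3_le : 10584 * (s3 * (p + d - 3) + s4) ≤ 10584 * (s3B * (p + d - 3) + s4B) := by
    gcongr
  have hR4_le : RSK 10 * piAll + (RBK 10 - RSK 10) * piS0 ≤ RSK 10 * piAllB + (RBK 10 - RSK 10) * piS0B := by
    gcongr
  have hY' : 7560 * (∑ j ∈ Finset.Ico 5 p, (p + d).choose j +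
      (𝒯₃.card * (p + d - 3).choose (p - 3) + 𝒯₄.card * (p + d - 4).choose (p - 4))) ≤
      7560 * Matroid.midCount M p 4 + 10584 * (s3 * (p + d - 3) + s4) +
      (RSK 10 * piAll + (RBK 10 - RSK 10) * piS0) +
      7560 * ((𝒯₃.card + 𝒯₄.card).choose 2 * (p + d - 5).choose (p - 5)) := hY
  omega

/-- **What `ladderOK` with the mixed kill credit means**: on the capped core `N` of rank `p` with `m₃` triangles and
`m₄` four-circuits pairwise covering `≥ 5` points, `Φ(p0, 4)·#U_N(p, 4) + B ≤ #Y_N(p, 4) + A` once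
`ladderOK p0 p d P S S5 (A + m₃·C(n − 3, p − 3) + m₄·C(n − 4, p − 4)) (B + C(m₃ + m₄, 2)·C(n − 5, p − 5)) = true`. -/
theorem weighted_of_ladderOK_kill_mixed (N : Matroid α) [N.Finite] (p0 p d P S S5 A B : ℕ) (hd4 : 4 ≤ d)
    (hR : N.eRank = (p : ℕ∞)) (hn : N.E.ncard = p + d)
    (hfree : ∀ e ∈ N.E, ∃ X ⊆ N.E \ {e}, e ∉ N.closure X ∧ e ∉ N.closure ((N.E \ {e}) \ X))
    (hP : {C : Set α | N.IsCircuit C ∧ C.ncard = 3}.ncard ≤ P) (hS : {C : Set α | N.IsCircuit C ∧ C.ncard = 4}.ncard ≤ S)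
    (hS5 : {C : Set α | N.IsCircuit C ∧ C.ncard = 5}.ncard ≤ S5)
    (hp : 5 ≤ p) (hp0 : 5 ≤ p0) (𝒯₃ 𝒯₄ : Finset (Set α)) (h𝒯₃ : ∀ C ∈ 𝒯₃, N.IsCircuit C ∧ C.ncard = 3)
    (h𝒯₄ : ∀ C ∈ 𝒯₄, N.IsCircuit C ∧ C.ncard = 4)
    (hpair : ∀ C ∈ 𝒯₃ ∪ 𝒯₄, ∀ C' ∈ 𝒯₃ ∪ 𝒯₄, C ≠ C' → 5 ≤ (C ∪ C').ncard)
    (hok : ladderOK p0 p d P S S5 (A + (𝒯₃.card * (p + d - 3).choose (p - 3) + 𝒯₄.card * (p + d - 4).choose (p - 4)))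
      (B + (𝒯₃.card + 𝒯₄.card).choose 2 * (p + d - 5).choose (p - 5)) = true) :
    phiK p0 4 * (Matroid.topCount N p 4 : ℚ) + B ≤ (Matroid.midCount N p 4 : ℚ) + A := by
  have hUB := (cell_bounds N p d P S S5 hd4 hR hn hfree hP hS hS5 hp).1
  have hYB := cellYsum_kill_le_mixed N p d P S S5 hd4 hR hn hfree hP hS hS5 hp 𝒯₃ 𝒯₄ h𝒯₃ h𝒯₄ hpair
  unfold ladderOK at hok
  simp only [CoreRegimes.chooseF_eq] at hok
  have hok' := of_decide_eq_true hok
  set phiNum := 2 ^ (p0 + 4) - 2 * ∑ u ∈ Finset.range 5, (p0 + 4).choose u with hphiNum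
  set phiDen := (p0 + 4).choose 4 with hphiDen
  set UB := cellUB p d P S S5
  set R34 := cellR34 p d P S S5
  set Ysum := cellYsum p d
  set T := Matroid.topCount N p 4
  set Y := Matroid.midCount N p 4
  set KA := 𝒯₃.card * (p + d - 3).choose (p - 3) + 𝒯₄.card * (p + d - 4).choose (p - 4) with hKA
  set KB := (𝒯₃.card + 𝒯₄.card).choose 2 * (p + d - 5).choose (p - 5) with hKB
  -- the `ℕ` chain
  have h1 : phiNum * (7560 * T) ≤ phiNum * UB := Nat.mul_le_mul_left _ hUB
  have h2 : phiDen * (Ysum + 7560 * KA) ≤ phiDen * (7560 * Y + R34 + 7560 * KB) := Nat.mul_le_mul_left _ hYB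
  have hchain : phiNum * (7560 * T) + phiDen * (7560 * B) ≤ phiDen * (7560 * Y) + phiDen * (7560 * A) := by
    have e1 : phiDen * (R34 + 7560 * (B + KB)) = phiDen * R34 + phiDen * (7560 * B) + phiDen * (7560 * KB) := by ring
    have e2 : phiDen * (Ysum + 7560 * (A + KA)) = phiDen * Ysum + phiDen * (7560 * A) + phiDen * (7560 * KA) := by ring
    have e3 : phiDen * (7560 * Y + R34 + 7560 * KB) = phiDen * (7560 * Y) + phiDen * R34 + phiDen * (7560 * KB) := by
      ring
    have e4 : phiDen * (Ysum + 7560 * KA) = phiDen * Ysum + phiDen * (7560 * KA) := by ring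
    rw [e1, e2] at hok'
    rw [e3, e4] at h2
    omega
  -- to `ℚ`
  have hsum : 2 * ∑ u ∈ Finset.range 5, (p0 + 4).choose u ≤ 2 ^ (p0 + 4) := by
    have := sum_Ioo_choose_add_four p0 hp0
    omega
  have hphiNumQ : (phiNum : ℚ) = 2 ^ (p0 + 4) - 2 * ∑ u ∈ Finset.range 5, ((p0 + 4).choose u : ℚ) := by
    rw [hphiNum, Nat.cast_sub hsum]
    push_cast
    ring
  have hΦ := phiK_four_mul_choose_eq p0 hp0
  rw [← hphiNumQ] at hΦ
  have hDenPos : (0 : ℚ) < (phiDen : ℚ) := by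
    rw [hphiDen]; exact_mod_cast Nat.choose_pos (by omega)
  have hchainQ : (phiNum : ℚ) * (7560 * (T : ℚ)) + (phiDen : ℚ) * (7560 * (B : ℚ)) ≤
      (phiDen : ℚ) * (7560 * (Y : ℚ)) + (phiDen : ℚ) * (7560 * (A : ℚ)) := by
    have h : ((phiNum * (7560 * T) + phiDen * (7560 * B) : ℕ) : ℚ) ≤
        ((phiDen * (7560 * Y) + phiDen * (7560 * A) : ℕ) : ℚ) := by exact_mod_cast hchain
    push_cast at h
    linarith
  have hkey : (phiK p0 4 * (T : ℚ) + (B : ℚ)) * (phiDen : ℚ) ≤ ((Y : ℚ) + (A : ℚ)) * (phiDen : ℚ) := by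
    have e : (phiK p0 4 * (T : ℚ) + (B : ℚ)) * (phiDen : ℚ) =
        (phiK p0 4 * (phiDen : ℚ)) * (T : ℚ) + (phiDen : ℚ) * (B : ℚ) := by ring
    rw [e, hphiDen, hΦ, ← hphiDen]
    nlinarith [hchainQ]
  exact le_of_mul_le_mul_right hkey hDenPos

/-- **THE COLOOP-FREE CASE OF A CELL BY THE MIXED KILL WITH PER-`t` CAPS**: a coloop-free `e`-free core of rank
`p ≥ 5` on `p + d` points (`d ≥ 4`) with the triangle cap `P`, the four-circuit cap `S t` at triangle count `t`
(supplied) and the five-circuit cap `S5` satisfies `RLS` at `(p, 4)` once, at every `t ≤ P`, the two kernel lines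
pass: `s₄ < m₄ t` — the plain line at the cap `m₄ t − 1` with the kill of `mk t ≤ t` triangles; `s₄ ≥ m₄ t` — the
line at the cap `S t` with the kill of `mk t` triangles and `m₄ t` four-circuits. -/
theorem rls_of_kill_case_mixed_capT (M : Matroid α) [M.Finite] {p d : ℕ}
    (hR : M.eRank = (p : ℕ∞)) (hn : M.E.ncard = p + d)
    (hfree : ∀ e ∈ M.E, ∃ A ⊆ M.E \ {e}, e ∉ M.closure A ∧ e ∉ M.closure ((M.E \ {e}) \ A))
    (hc : M.coloops = ∅) (hp : 5 ≤ p) (hd4 : 4 ≤ d) {P S5 : ℕ} (S : ℕ → ℕ)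
    (hP : min ((p + d) * TriangleCap.cq3 (d - 1) / (p + d - 3)) (TriangleCap.cq3 d) ≤ P)
    (hScap : ∀ (N : Matroid α) [N.Finite],
      (∀ e ∈ N.E, ∃ A ⊆ N.E \ {e}, e ∉ N.closure A ∧ e ∉ N.closure ((N.E \ {e}) \ A)) →
      N.E.encard = N.eRank + ((d : ℕ) : ℕ∞) → N.E.ncard = p + d → N.coloops = ∅ →
      ∀ t, {C : Set α | N.IsCircuit C ∧ C.ncard = 3}.ncard = t →
      {C : Set α | N.IsCircuit C ∧ C.ncard = 4}.ncard ≤ S t)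
    (hS5 : (p + d) * avgChain5b (d - 1) / (p + d - 5) ≤ S5)
    (mk m₄ : ℕ → ℕ) (hmk : ∀ t ∈ Finset.range (P + 1), mk t ≤ t)
    (hsmall : ∀ t ∈ Finset.range (P + 1), ladderOK p p d t (m₄ t - 1) S5 (mk t * (p + d - 3).choose (p - 3))
      ((mk t).choose 2 * (p + d - 5).choose (p - 5)) = true)
    (hbig : ∀ t ∈ Finset.range (P + 1), ladderOK p p d t (S t) S5
      (mk t * (p + d - 3).choose (p - 3) + m₄ t * (p + d - 4).choose (p - 4))
      ((mk t + m₄ t).choose 2 * (p + d - 5).choose (p - 5)) = true) :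
    ThmN.RLS M p 4 := by
  classical
  have hd : M.E.encard = M.eRank + ((d - 1 + 1 : ℕ) : ℕ∞) := by
    rw [hR, ← M.ground_finite.cast_ncard_eq, hn, show d - 1 + 1 = d by omega]
    push_cast
    ring
  have hd' : M.E.encard = M.eRank + (((d - 1 : ℕ) : ℕ∞) + 1) := by rw [hd, Nat.cast_succ]
  have hdd : M.E.encard = M.eRank + ((d : ℕ) : ℕ∞) := by rw [hd, show d - 1 + 1 = d by omega]
  have hP' : {C : Set α | M.IsCircuit C ∧ C.ncard = 3}.ncard ≤ P :=
    (le_min (ncard_triangles_le_of_coloopFree M hfree hd hc hn (by omega))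
      (TriangleCap.core_ncard_triangles_le_cq3 M hfree hdd)).trans hP
  have hS' := hScap M hfree hdd hn hc _ rfl
  have hS5' := (ncard_fiveCircuits_le_of_coloopFree M hfree hd' hc hn (by omega)).trans hS5
  have hC1 : ∀ L ⊆ M.E, M.eRk L = 2 → L.ncard ≤ 3 := by
    intro L hL hr
    have := ThmN.ncard_add_one_le_two_pow_of_eRk_le M (ThmN.not_isLoop_of_free M hfree) hfree 2 L hL hr.le
    omega
  set t := {C : Set α | M.IsCircuit C ∧ C.ncard = 3}.ncard with ht
  set u := {C : Set α | M.IsCircuit C ∧ C.ncard = 4}.ncard with hu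
  have htI : t ∈ Finset.range (P + 1) := Finset.mem_range.2 (by omega)
  -- the triangles of the kill
  have h𝒯₃ : ∃ 𝒯₃ : Finset (Set α), 𝒯₃.card = mk t ∧ ∀ C ∈ 𝒯₃, M.IsCircuit C ∧ C.ncard = 3 := by
    rcases Nat.eq_zero_or_pos (mk t) with h0 | hpos
    · exact ⟨∅, by rw [h0, Finset.card_empty], fun C hC => absurd hC (Finset.notMem_empty C)⟩
    · obtain ⟨𝒯, h1, h2⟩ := exists_finset_of_le_ncard hpos ((hmk t htI).trans (le_of_eq ht))
      exact ⟨𝒯, h1, h2⟩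
  obtain ⟨𝒯₃, h𝒯₃card, h𝒯₃mem⟩ := h𝒯₃
  have hpair₃ : ∀ C ∈ 𝒯₃, ∀ C' ∈ 𝒯₃, C ≠ C' → 5 ≤ (C ∪ C').ncard := fun C hC C' hC' hne =>
    five_le_ncard_union_of_triangles M hC1 (h𝒯₃mem C hC) (h𝒯₃mem C' hC') hne
  rw [ThmN.RLS_iff]
  rcases Nat.lt_or_ge u (m₄ t) with hsmallu | hbigu
  · -- `s₄ < m₄ t`: the plain line at the cap `m₄ t − 1` with the triangle kill
    have hw := weighted_of_ladderOK_kill M p p d t (m₄ t - 1) S5 0 0 hd4 hR hn hfree le_rfl (by omega) hS5' hp hp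
      3 (by omega) 𝒯₃ h𝒯₃mem hpair₃ (by rw [h𝒯₃card]; simpa using hsmall t htI)
    simpa using hw
  · -- `s₄ ≥ m₄ t`: the mixed kill at the cap `S t`
    have h𝒯₄ : ∃ 𝒯₄ : Finset (Set α), 𝒯₄.card = m₄ t ∧ ∀ C ∈ 𝒯₄, M.IsCircuit C ∧ C.ncard = 4 := by
      rcases Nat.eq_zero_or_pos (m₄ t) with h0 | hpos
      · exact ⟨∅, by rw [h0, Finset.card_empty], fun C hC => absurd hC (Finset.notMem_empty C)⟩
      · obtain ⟨𝒯, h1, h2⟩ := exists_finset_of_le_ncard hpos (hbigu.trans (le_of_eq hu))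
        exact ⟨𝒯, h1, h2⟩
    obtain ⟨𝒯₄, h𝒯₄card, h𝒯₄mem⟩ := h𝒯₄
    have hpair : ∀ C ∈ 𝒯₃ ∪ 𝒯₄, ∀ C' ∈ 𝒯₃ ∪ 𝒯₄, C ≠ C' → 5 ≤ (C ∪ C').ncard := by
      intro C hC C' hC' hne
      rw [Finset.mem_union] at hC hC'
      rcases hC with h3 | h4 <;> rcases hC' with h3' | h4'
      · exact hpair₃ C h3 C' h3' hne
      · exact five_le_ncard_union_of_triangle_four_circuit M (h𝒯₃mem C h3) (h𝒯₄mem C' h4')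
      · rw [Set.union_comm]
        exact five_le_ncard_union_of_triangle_four_circuit M (h𝒯₃mem C' h3') (h𝒯₄mem C h4)
      · exact five_le_ncard_union_of_four_circuits M (h𝒯₄mem C h4) (h𝒯₄mem C' h4') hne
    have hw := weighted_of_ladderOK_kill_mixed M p p d t (S t) S5 0 0 hd4 hR hn hfree le_rfl hS' hS5' hp hp
      𝒯₃ 𝒯₄ h𝒯₃mem h𝒯₄mem hpair (by rw [h𝒯₃card, h𝒯₄card]; simpa using hbig t htI)
    simpa using hw

end S1

end PercRepro
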